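import Literature.NumberTheory.EllipticCurves.ShaRestrictionJZeroInvariants
import HarnessLib

/-!
# `Sel_{p^∞}(E/ℚ) = Sel_{p^∞}(E_K/K)^{Gal(K/ℚ)}` for `j = 0` short models and `K = ℚ(ω)`

The exact descent along `K = ℚ(ω) ⊇ ℚ` for an elliptic curve `E : y² = x³ + B` over `ℚ` (all of
`a₁, …, a₄` zero) on the `p^∞`-SELMER side, for every `p` (the route uses `p = 2`): the restriction
`res : H¹(ℚ, E[p^∞]) → H¹(K, E_K[p^∞])` (the tree's `resPrimary`) is

* INJECTIVE (`JZero.resPrimary_injective`) — the kernel `H¹(Gal(K/ℚ), E_K[p^∞](K))` vanishes by the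
  `[ω]`-trick (`resSubgroupH1_injective_of_semilinear` of `ShaRestrictionJZeroCorestriction`, the
  coefficient module `E[p^∞]` being `[ω]`-stable), and
* ONTO the invariants of the chosen lift `τ = liftAut σ` of the generator `σ` of `Gal(K/ℚ)`
  (`JZero.exists_resPrimary_eq_of_conjH1Primary_eq`, `JZero.range_resPrimary_eq`) — CM corestriction
  `c₀ = cor(−[ω]_* s)` (`exists_resSubgroupH1_eq_of_conjH1_eq`),

both transported through the tree's subgroup model `modelIso : H¹(Γ_K, E_K[p^∞]) ≃ H¹(galRange K, E[p^∞])`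
(`modelIso_resPrimary`, `modelIso_conjH1Primary`, files `SelmerPInftyRestriction`,
`SelmerPInftyModelAction`). Since `Sel_{p^∞}(E/ℚ) = res⁻¹ Sel_{p^∞}(E_K/K)`
(`resPrimary_mem_selmerGroupPInfty`, `JZero.mem_selmerGroupPInfty_of_res_mem`), restriction is a
bijection `Sel_{p^∞}(E/ℚ) ≅ Sel_{p^∞}(E_K/K)^{τ}`
(`JZero.existsUnique_resPrimary_eq_of_mem_selmerGroupPInfty`,
`JZero.image_resPrimary_selmerGroupPInfty_eq`): LEMMA K0's Selmer clause
«`Sel_{2^∞}(X/K) = Sel_{2^∞}(X/ℚ) ⊗ 𝒪₂`» in its `σ`-eigen form. Everything here is proved; no new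
definitions (the restriction of `[ω]` to `E[p^∞]` is built inside the proofs).

## References

* J.-P. Serre, *Galois Cohomology* (1997), I.§2.4–2.5, I.§5.8. [SerreGaloisCohomology1997]
* B. H. Gross, Kolyvagin's work on modular elliptic curves (1991), §5 (5.1)–(5.2). [GrossLMS1991]
* T. Dokchitser, V. Dokchitser, Ann. of Math. 172 (2010), Lemma 4.14 (proof). [DokchitserDokchitserAnnals2010]
* J. H. Silverman, *The Arithmetic of Elliptic Curves*, 2nd ed. (2009), III.10.1. [SilvermanAEC2009]
-/

noncomputable section

open scoped Classical

namespace Literature.NumberTheory.EllipticCurves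

open GaloisRepresentations WeierstrassCurve Literature.NumberTheory.QuadraticFields

namespace JZero

variable (K : Type) [Field K] [NumberField K] (W : WeierstrassCurve ℚ) [W.IsElliptic] (p : ℕ)

/-! ## The restriction of `[ω]` to `E[p^∞]` -/

omit [W.IsElliptic] in
/-- An additive automorphism of `E(ℚ̄)` maps `E[p^∞]` into itself. [folklore] -/
private theorem mem_geomPrimaryTorsion_of_addEquiv (ψ : geomPoints W ≃+ geomPoints W)
    {P : geomPoints W} (hP : P ∈ geomPrimaryTorsion W p) : ψ P ∈ geomPrimaryTorsion W p :=
  map_mem_primaryComponent (ψ : geomPoints W →+ geomPoints W) hP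

/-- **`[ω]` on `E[p^∞]`.** For an elliptic `j = 0` short model over `ℚ` and a primitive cube root of
unity `ζ' ∈ ℚ̄`: an additive automorphism `ψ` of `E[p^∞] ⊆ E(ℚ̄)` (the restriction of `[ω]`,
`JZero.exists_cm_addEquiv_semilinear`) commuting with every `g ∈ Γ_ℚ` fixing `ζ'`, semilinear
(`g ψ = ψ² g`) for `g ζ' = ζ'²`, with `ψ² + ψ + 1 = 0`. Silverman, *AEC*, III.10.1. [folklore] -/
private theorem exists_cm_addEquiv_primary (ha₁ : W.a₁ = 0) (ha₂ : W.a₂ = 0) (ha₃ : W.a₃ = 0)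
    (ha₄ : W.a₄ = 0) {ζ' : AlgebraicClosure ℚ} (hζ'3 : ζ' ^ 3 = 1) (hζ'1 : ζ' ≠ 1) :
    ∃ ψ : geomPrimaryTorsion W p ≃+ geomPrimaryTorsion W p,
      (∀ g : Field.absoluteGaloisGroup ℚ,
        (show AlgebraicClosure ℚ ≃ₐ[ℚ] AlgebraicClosure ℚ from g) ζ' = ζ' →
          ∀ P : geomPrimaryTorsion W p, ψ (g • P) = g • ψ P) ∧
      (∀ g : Field.absoluteGaloisGroup ℚ,
        (show AlgebraicClosure ℚ ≃ₐ[ℚ] AlgebraicClosure ℚ from g) ζ' = ζ' ^ 2 →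
          ∀ P : geomPrimaryTorsion W p, g • ψ P = ψ (ψ (g • P))) ∧
      ∀ P : geomPrimaryTorsion W p, ψ (ψ P) + ψ P + P = 0 := by
  obtain ⟨ψ, -, h1, h2, h3⟩ := exists_cm_addEquiv_semilinear (W := W) ha₁ ha₂ ha₃ ha₄ hζ'3 hζ'1
  let ψp : geomPrimaryTorsion W p ≃+ geomPrimaryTorsion W p :=
    { toFun := fun P ↦ ⟨ψ P, mem_geomPrimaryTorsion_of_addEquiv W p ψ P.2⟩
      invFun := fun Q ↦ ⟨ψ.symm Q, mem_geomPrimaryTorsion_of_addEquiv W p ψ.symm Q.2⟩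
      left_inv := fun P ↦ Subtype.ext (ψ.symm_apply_apply (P : geomPoints W))
      right_inv := fun Q ↦ Subtype.ext (ψ.apply_symm_apply (Q : geomPoints W))
      map_add' := fun P Q ↦ Subtype.ext (map_add ψ (P : geomPoints W) (Q : geomPoints W)) }
  have hψp : ∀ P : geomPrimaryTorsion W p, ((ψp P : geomPrimaryTorsion W p) : geomPoints W) = ψ P :=
    fun _ ↦ rfl
  refine ⟨ψp, fun g hg P ↦ Subtype.ext ?_, fun g hg P ↦ Subtype.ext ?_, fun P ↦ Subtype.ext ?_⟩
  · rw [hψp, primaryComponent.coe_smul, primaryComponent.coe_smul, hψp]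
    exact h1 g hg P
  · rw [primaryComponent.coe_smul, hψp, hψp, hψp, primaryComponent.coe_smul]
    exact h2 g hg P
  · rw [AddSubgroup.coe_add, AddSubgroup.coe_add, AddSubgroup.coe_zero]
    exact h3 P

omit [W.IsElliptic] in
/-- `σ ζ = ζ²` for a primitive cube root of unity forces `σ ≠ 1`. [folklore] -/
private theorem ne_one_of_apply_eq_sq'' {ζ : K} (hζ : IsPrimitiveRoot ζ 3) {σ : K ≃ₐ[ℚ] K}
    (hσζ : σ ζ = ζ ^ 2) : σ ≠ 1 := by
  intro h
  rw [h, AlgEquiv.one_apply] at hσζ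
  have hζ0 : ζ ≠ 0 := hζ.ne_zero (by norm_num)
  have hζ1 : ζ ≠ 1 := hζ.ne_one (by norm_num)
  have : ζ * (ζ - 1) = 0 := by linear_combination hσζ.symm
  rcases mul_eq_zero.mp this with h0 | h0
  · exact hζ0 h0
  · exact hζ1 (sub_eq_zero.mp h0)

omit [W.IsElliptic] in
/-- `K = ℚ + ℚ ζ` for a quadratic number field with a primitive cube root of unity `ζ`
(`Quadratic.exists_eq_add_mul`, as `ζ ∉ ℚ`). [folklore] -/
private theorem exists_eq_add_mul_of_isPrimitiveRoot (h2 : Module.finrank ℚ K = 2) {ζ : K}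
    (hζ : IsPrimitiveRoot ζ 3) :
    ζ ^ 2 + ζ + 1 = 0 ∧ ∀ x : K, ∃ a b : ℚ, x = algebraMap ℚ K a + algebraMap ℚ K b * ζ := by
  have h3 : ζ ^ 3 = 1 := hζ.pow_eq_one
  have h1 : ζ ≠ 1 := hζ.ne_one (by norm_num)
  have hω : ζ ^ 2 + ζ + 1 = 0 := by
    have hprod : (ζ - 1) * (ζ ^ 2 + ζ + 1) = 0 := by linear_combination h3
    rcases mul_eq_zero.mp hprod with h | h
    · exact absurd (sub_eq_zero.mp h) h1
    · exact h
  have hnot : ζ ∉ Set.range (algebraMap ℚ K) := by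
    rintro ⟨q, hq⟩
    have hq2 : q ^ 2 + q + 1 = 0 := by
      apply (algebraMap ℚ K).injective
      rw [map_add, map_add, map_pow, map_one, map_zero, hq, hω]
    nlinarith [sq_nonneg (2 * q + 1)]
  exact ⟨hω, Quadratic.exists_eq_add_mul h2 hnot⟩

/-! ## Injectivity and the image of `res : H¹(ℚ, E[p^∞]) → H¹(K, E_K[p^∞])` -/

/-- **`res : H¹(ℚ, E[p^∞]) → H¹(K, E_K[p^∞])` is INJECTIVE** for `E = W/ℚ` elliptic with all of
`a₁, …, a₄` zero, `K` a quadratic number field with a primitive cube root of unity `ζ` and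
`σ ζ = ζ²` (any `p`): `H¹(Gal(K/ℚ), E_K[p^∞](K)) = 0` by the `[ω]`-trick
(`resSubgroupH1_injective_of_semilinear` on the `[ω]`-stable module `E[p^∞]`), transported through the
subgroup model (`modelIso_resPrimary`). Compare the tree's `two_nsmul_eq_zero_of_resPrimary_eq_zero`
(kernel killed by `2`, any quadratic `K`). [cite: SerreGaloisCohomology1997, I.§2.4 (Prop. 9 and Cor.) and I.§5.8]
[cite: SilvermanAEC2009, Thm. III.10.1 and Cor. III.10.2] -/
theorem resPrimary_injective (ha₁ : W.a₁ = 0) (ha₂ : W.a₂ = 0) (ha₃ : W.a₃ = 0) (ha₄ : W.a₄ = 0)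
    (h2 : Module.finrank ℚ K = 2) {ζ : K} (hζ : IsPrimitiveRoot ζ 3) {σ : K ≃ₐ[ℚ] K}
    (hσζ : σ ζ = ζ ^ 2) : Function.Injective (resPrimary W K p) := by
  haveI : IsGalois ℚ K := by
    haveI : Algebra.IsQuadraticExtension ℚ K := ⟨h2⟩
    infer_instance
  have hσ1 : σ ≠ 1 := ne_one_of_apply_eq_sq'' K hζ hσζ
  haveI hNn : (galRange (K := ℚ) K).Normal := normal_galRange K h2 hσ1
  have hN : IsOpen (galRange (K := ℚ) K : Set (Field.absoluteGaloisGroup ℚ)) := isOpen_galRange K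
  have hc := xor_galRange K h2 hσ1
  obtain ⟨ζ', hζ'⟩ : ∃ ζ' : AlgebraicClosure ℚ, embIntoClosure (K := ℚ) K ζ = ζ' := ⟨_, rfl⟩
  have hζ'3 : ζ' ^ 3 = 1 := by rw [← hζ', ← map_pow, hζ.pow_eq_one, map_one]
  have hζ'1 : ζ' ≠ 1 :=
    (hζ' ▸ hζ.map_of_injective (embIntoClosure (K := ℚ) K).injective).ne_one (by norm_num)
  have hcζ : (show AlgebraicClosure ℚ ≃ₐ[ℚ] AlgebraicClosure ℚ from liftToAbsGal (K := ℚ) K σ) ζ' =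
      ζ' ^ 2 := by
    rw [← hζ']
    exact (liftToAbsGal_embIntoClosure (K := ℚ) K σ ζ).trans (by rw [hσζ, map_pow])
  obtain ⟨ψ, hψ1, hψ2, hψ3⟩ := exists_cm_addEquiv_primary W p ha₁ ha₂ ha₃ ha₄ hζ'3 hζ'1
  have hψN : ∀ (n : galRange (K := ℚ) K) (m : geomPrimaryTorsion W p), ψ (n • m) = n • ψ m :=
    fun n m ↦ hψ1 n.1 (by rw [← hζ']; exact smul_embIntoClosure_of_mem_galRange K n.2 ζ) m
  have hinj := resSubgroupH1_injective_of_semilinear hN hc ψ hψN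
    (fun m ↦ hψ2 _ hcζ m) hψ3
  intro x y hxy
  have h := congrArg (modelIso K W p) hxy
  rw [modelIso_resPrimary, modelIso_resPrimary] at h
  exact hinj h

omit [W.IsElliptic] in
/-- **`τ_* ∘ res = res` on `H¹(ℚ, E[p^∞])`** (for `K` quadratic and `σ ≠ 1`): restricted classes
are invariant under the action of the chosen lift
`τ = liftAut σ` (`IsLiftOfAut.conjH1Primary`) — conjugation acts trivially on restricted classes
(`conjH1_resSubgroupH1`) under the subgroup model (`modelIso_conjH1Primary`).
[cite: SerreGaloisCohomology1997, I.§2.4 (Prop. 9 and Cor.) and I.§5.8] [cite: GrossLMS1991, §5 (5.1)] -/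
theorem conjH1Primary_resPrimary (h2 : Module.finrank ℚ K = 2) {σ : K ≃ₐ[ℚ] K} (hσ1 : σ ≠ 1)
    (η : galH1Primary W p) :
    (isLiftOfAut_liftAut σ).conjH1Primary W p (resPrimary W K p η) = resPrimary W K p η := by
  haveI : IsGalois ℚ K := by
    haveI : Algebra.IsQuadraticExtension ℚ K := ⟨h2⟩
    infer_instance
  haveI hNn : (galRange (K := ℚ) K).Normal := normal_galRange K h2 hσ1
  have hM : ∀ m : geomPrimaryTorsion W p, Continuous fun g : Field.absoluteGaloisGroup ℚ ↦ g • m :=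
    fun m ↦ continuous_induced_rng.2 (by
      change Continuous fun g : Field.absoluteGaloisGroup ℚ ↦
        ((g • m : geomPrimaryTorsion W p) : geomPoints W)
      simp only [primaryComponent.coe_smul]
      exact continuous_smul_of_isOpen_stabilizer (m : geomPoints W)
        (isOpen_stabilizer_point_holds W _))
  apply (modelIso K W p).injective
  rw [modelIso_conjH1Primary K W p σ h2 hσ1, modelIso_resPrimary]
  exact conjH1_resSubgroupH1 (galRange (K := ℚ) K) hM _ η

/-- **INVARIANT CLASSES OF `H¹(K, E_K[p^∞])` ARE RESTRICTIONS**: for `E`, `K`, `ζ`, `σ` as in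
`resPrimary_injective` and the chosen lift `τ = liftAut σ`, every `s ∈ H¹(K, E_K[p^∞])` with
`τ_* s = s` (`IsLiftOfAut.conjH1Primary`) is `res η` (`resPrimary`) for some `η ∈ H¹(ℚ, E[p^∞])`:
CM corestriction `η = cor(−[ω]_* s)` (`exists_resSubgroupH1_eq_of_conjH1_eq` on `E[p^∞]`) under
the subgroup model (`modelIso_conjH1Primary`, `modelIso_resPrimary`).
[cite: SerreGaloisCohomology1997, I.§2.4 (Prop. 9 and Cor.) and I.§5.8] [cite: GrossLMS1991, §5 (5.1)] -/
theorem exists_resPrimary_eq_of_conjH1Primary_eq (ha₁ : W.a₁ = 0) (ha₂ : W.a₂ = 0)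
    (ha₃ : W.a₃ = 0) (ha₄ : W.a₄ = 0) (h2 : Module.finrank ℚ K = 2) {ζ : K}
    (hζ : IsPrimitiveRoot ζ 3) {σ : K ≃ₐ[ℚ] K} (hσζ : σ ζ = ζ ^ 2)
    {s : galH1Primary (W.baseChange K) p} (hs : (isLiftOfAut_liftAut σ).conjH1Primary W p s = s) :
    ∃ η : galH1Primary W p, resPrimary W K p η = s := by
  haveI : IsGalois ℚ K := by
    haveI : Algebra.IsQuadraticExtension ℚ K := ⟨h2⟩
    infer_instance
  have hσ1 : σ ≠ 1 := ne_one_of_apply_eq_sq'' K hζ hσζ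
  haveI hNn : (galRange (K := ℚ) K).Normal := normal_galRange K h2 hσ1
  have hN : IsOpen (galRange (K := ℚ) K : Set (Field.absoluteGaloisGroup ℚ)) := isOpen_galRange K
  have hc := xor_galRange K h2 hσ1
  have hM : ∀ m : geomPrimaryTorsion W p, Continuous fun g : Field.absoluteGaloisGroup ℚ ↦ g • m :=
    fun m ↦ continuous_induced_rng.2 (by
      change Continuous fun g : Field.absoluteGaloisGroup ℚ ↦
        ((g • m : geomPrimaryTorsion W p) : geomPoints W)
      simp only [primaryComponent.coe_smul]
      exact continuous_smul_of_isOpen_stabilizer (m : geomPoints W)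
        (isOpen_stabilizer_point_holds W _))
  obtain ⟨ζ', hζ'⟩ : ∃ ζ' : AlgebraicClosure ℚ, embIntoClosure (K := ℚ) K ζ = ζ' := ⟨_, rfl⟩
  have hζ'3 : ζ' ^ 3 = 1 := by rw [← hζ', ← map_pow, hζ.pow_eq_one, map_one]
  have hζ'1 : ζ' ≠ 1 :=
    (hζ' ▸ hζ.map_of_injective (embIntoClosure (K := ℚ) K).injective).ne_one (by norm_num)
  have hcζ : (show AlgebraicClosure ℚ ≃ₐ[ℚ] AlgebraicClosure ℚ from liftToAbsGal (K := ℚ) K σ) ζ' =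
      ζ' ^ 2 := by
    rw [← hζ']
    exact (liftToAbsGal_embIntoClosure (K := ℚ) K σ ζ).trans (by rw [hσζ, map_pow])
  obtain ⟨ψ, hψ1, hψ2, hψ3⟩ := exists_cm_addEquiv_primary W p ha₁ ha₂ ha₃ ha₄ hζ'3 hζ'1
  have hψN : ∀ (n : galRange (K := ℚ) K) (m : geomPrimaryTorsion W p), ψ (n • m) = n • ψ m :=
    fun n m ↦ hψ1 n.1 (by rw [← hζ']; exact smul_embIntoClosure_of_mem_galRange K n.2 ζ) m
  have hξ : conjH1 (galRange (K := ℚ) K) (geomPrimaryTorsion W p) (liftToAbsGal (K := ℚ) K σ)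
      (modelIso K W p s) = modelIso K W p s := by
    rw [← modelIso_conjH1Primary K W p σ h2 hσ1, hs]
  obtain ⟨η, hη⟩ :=
    Literature.NumberTheory.EllipticCurves.exists_resSubgroupH1_eq_of_conjH1_eq hN hM hc ψ hψN
      (fun m ↦ hψ2 _ hcζ m) hψ3 hξ
  refine ⟨η, (modelIso K W p).injective ?_⟩
  rw [modelIso_resPrimary]
  exact hη

/-- **`res(H¹(ℚ, E[p^∞])) = H¹(K, E_K[p^∞])^{τ}`** (set form).
[cite: SerreGaloisCohomology1997, I.§2.4 (Prop. 9 and Cor.) and I.§5.8] [cite: GrossLMS1991, §5 (5.1)] -/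
theorem range_resPrimary_eq (ha₁ : W.a₁ = 0) (ha₂ : W.a₂ = 0) (ha₃ : W.a₃ = 0) (ha₄ : W.a₄ = 0)
    (h2 : Module.finrank ℚ K = 2) {ζ : K} (hζ : IsPrimitiveRoot ζ 3) {σ : K ≃ₐ[ℚ] K}
    (hσζ : σ ζ = ζ ^ 2) :
    ((resPrimary W K p).range : Set (galH1Primary (W.baseChange K) p)) =
      {s | (isLiftOfAut_liftAut σ).conjH1Primary W p s = s} := by
  ext s
  simp only [SetLike.mem_coe, AddMonoidHom.mem_range, Set.mem_setOf_eq]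
  constructor
  · rintro ⟨η, rfl⟩
    exact conjH1Primary_resPrimary K W p h2 (ne_one_of_apply_eq_sq'' K hζ hσζ) η
  · exact fun hs ↦ exists_resPrimary_eq_of_conjH1Primary_eq K W p ha₁ ha₂ ha₃ ha₄ h2 hζ hσζ hs

/-! ## The Selmer groups: `Sel_{p^∞}(E/ℚ) ≅ Sel_{p^∞}(E_K/K)^{τ}` -/

/-- **`Sel_{p^∞}(E/ℚ) = res⁻¹ Sel_{p^∞}(E_K/K)`** in the cube-sum frame (the tree's
`resPrimary_mem_selmerGroupPInfty` and `JZero.mem_selmerGroupPInfty_of_res_mem` of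
`ShaRestrictionJZeroLocalDescent`). [cite: DokchitserDokchitserAnnals2010, Lemma 4.14 (proof)]
[cite: SerreGaloisCohomology1997, I.§2.4 (Prop. 9 and Cor.) and I.§5.8] -/
theorem mem_selmerGroupPInfty_iff_resPrimary_mem (ha₁ : W.a₁ = 0) (ha₂ : W.a₂ = 0)
    (ha₃ : W.a₃ = 0) (ha₄ : W.a₄ = 0) (h2 : Module.finrank ℚ K = 2) {ζ : K}
    (hζ : IsPrimitiveRoot ζ 3) (η : galH1Primary W p) :
    η ∈ selmerGroupPInfty W p ↔ resPrimary W K p η ∈ selmerGroupPInfty (W.baseChange K) p := by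
  obtain ⟨hω, hL⟩ := exists_eq_add_mul_of_isPrimitiveRoot K h2 hζ
  exact ⟨resPrimary_mem_selmerGroupPInfty W K p,
    fun h ↦ mem_selmerGroupPInfty_of_res_mem W K ha₁ ha₂ ha₃ ha₄ hω hL p (resPrimary W K p)
      (primaryH1ToH1_resPrimary W K p) h⟩

/-- **`Sel_{p^∞}(E/ℚ)` is the preimage of `Sel_{p^∞}(E_K/K)`** (subgroup form).
[cite: DokchitserDokchitserAnnals2010, Lemma 4.14 (proof)] -/
theorem selmerGroupPInfty_eq_comap_resPrimary (ha₁ : W.a₁ = 0) (ha₂ : W.a₂ = 0)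
    (ha₃ : W.a₃ = 0) (ha₄ : W.a₄ = 0) (h2 : Module.finrank ℚ K = 2) {ζ : K}
    (hζ : IsPrimitiveRoot ζ 3) :
    selmerGroupPInfty W p = (selmerGroupPInfty (W.baseChange K) p).comap (resPrimary W K p) := by
  ext η
  rw [AddSubgroup.mem_comap]
  exact mem_selmerGroupPInfty_iff_resPrimary_mem K W p ha₁ ha₂ ha₃ ha₄ h2 hζ η

/-- **LEMMA K0, Selmer clause: `res : Sel_{p^∞}(E/ℚ) ⥲ Sel_{p^∞}(E_K/K)^{τ}`.** For `E : y² = x³ + B`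
over `ℚ`, `K` quadratic with a primitive cube root of unity `ζ`, `σ ζ = ζ²`, `τ = liftAut σ`, and any
`p`: every `τ_*`-invariant element of `Sel_{p^∞}(E_K/K)` has EXACTLY ONE preimage under `res` in
`H¹(ℚ, E[p^∞])`, and that preimage lies in `Sel_{p^∞}(E/ℚ)`. (Memo: «`Sel_{2^∞}(X/K) = Sel_{2^∞}(X/ℚ) ⊗ 𝒪₂`»
in `σ`-eigen form; Gross 1991 §5 (5.1)–(5.2) is the odd-`p` Heegner analogue
`Sel(E/ℚ) ⥲ Sel(E/K)^{+}`.) [cite: GrossLMS1991, §5 (5.1)]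
[cite: SerreGaloisCohomology1997, I.§2.4 (Prop. 9 and Cor.) and I.§5.8] -/
theorem existsUnique_resPrimary_eq_of_mem_selmerGroupPInfty (ha₁ : W.a₁ = 0) (ha₂ : W.a₂ = 0)
    (ha₃ : W.a₃ = 0) (ha₄ : W.a₄ = 0) (h2 : Module.finrank ℚ K = 2) {ζ : K}
    (hζ : IsPrimitiveRoot ζ 3) {σ : K ≃ₐ[ℚ] K} (hσζ : σ ζ = ζ ^ 2)
    {s : galH1Primary (W.baseChange K) p} (hsel : s ∈ selmerGroupPInfty (W.baseChange K) p)
    (hs : (isLiftOfAut_liftAut σ).conjH1Primary W p s = s) :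
    ∃! η : galH1Primary W p, η ∈ selmerGroupPInfty W p ∧ resPrimary W K p η = s := by
  obtain ⟨η, hη⟩ := exists_resPrimary_eq_of_conjH1Primary_eq K W p ha₁ ha₂ ha₃ ha₄ h2 hζ hσζ hs
  refine ⟨η, ⟨(mem_selmerGroupPInfty_iff_resPrimary_mem K W p ha₁ ha₂ ha₃ ha₄ h2 hζ η).mpr
    (hη ▸ hsel), hη⟩, fun η' hη' ↦ ?_⟩
  exact resPrimary_injective K W p ha₁ ha₂ ha₃ ha₄ h2 hζ hσζ (hη'.2.trans hη.symm)

/-- **`res(Sel_{p^∞}(E/ℚ)) = Sel_{p^∞}(E_K/K) ∩ H¹(K, E_K[p^∞])^{τ}`** (image form).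
[cite: GrossLMS1991, §5 (5.1)] [cite: SerreGaloisCohomology1997, I.§2.4 (Prop. 9 and Cor.) and I.§5.8] -/
theorem image_resPrimary_selmerGroupPInfty_eq (ha₁ : W.a₁ = 0) (ha₂ : W.a₂ = 0) (ha₃ : W.a₃ = 0)
    (ha₄ : W.a₄ = 0) (h2 : Module.finrank ℚ K = 2) {ζ : K} (hζ : IsPrimitiveRoot ζ 3)
    {σ : K ≃ₐ[ℚ] K} (hσζ : σ ζ = ζ ^ 2) :
    resPrimary W K p '' (selmerGroupPInfty W p : Set (galH1Primary W p)) =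
      {s | s ∈ selmerGroupPInfty (W.baseChange K) p ∧
        (isLiftOfAut_liftAut σ).conjH1Primary W p s = s} := by
  ext s
  simp only [Set.mem_image, SetLike.mem_coe, Set.mem_setOf_eq]
  constructor
  · rintro ⟨η, hη, rfl⟩
    exact ⟨resPrimary_mem_selmerGroupPInfty W K p hη,
      conjH1Primary_resPrimary K W p h2 (ne_one_of_apply_eq_sq'' K hζ hσζ) η⟩
  · rintro ⟨hsel, hs⟩
    obtain ⟨η, ⟨hη, hres⟩, -⟩ := existsUnique_resPrimary_eq_of_mem_selmerGroupPInfty K W p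
      ha₁ ha₂ ha₃ ha₄ h2 hζ hσζ hsel hs
    exact ⟨η, hη, hres⟩

end JZero

end Literature.NumberTheory.EllipticCurves
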